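import Literature.Topology.FourManifolds.WrinklingMoveModel
import Literature.Topology.FourManifolds.AchiralLefschetzFibration
import HarnessLib

/-!
# Before the wrinkle: `W₀ = (t² - x² + y² - z², 2tx + 2yz)` is a positive Lefschetz point

Topic `Literature/Topology/FourManifolds`.  Lekili's wrinkling move (Lekili 2009, §3, Move 4;
the move `W` of Baykur–Saeki 2017, §3.1) deforms the map
`W₀(t, x, y, z) = (t² - x² + y² - z², 2 t x + 2 y z)` — the member `s = 0` of the family
`wrinklingMap s` (`WrinklingMoveModel.lean`) — into a wrinkled map with a triple cuspoid.  In the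
complex coordinates `z₁ = t + i x`, `z₂ = y + i z` one has `W₀ = z₁² + z₂²`, and
`z₁² + z₂² = (z₁ + i z₂)(z₁ - i z₂)`; so in the linear coordinates
`w₁ = z₁ + i z₂ = (t - z) + i (x + y)`, `w₂ = z₁ - i z₂ = (t + z) + i (x - y)` the map `W₀` is
the node `w₁ w₂` of the tree's Lefschetz model (`lefschetzNodeMap`,
`AchiralLefschetzFibration.lean`).  This file PROVES that `0` is a POSITIVE Lefschetz critical
point of `W₀` for the standard orientation of `ℝ⁴` (`IsLefschetzCriticalPoint … true`): the
coordinate change has determinant `4 > 0`.  Hence Move 4 really trades a (positive) Lefschetz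
singularity for the wrinkle.  No named fact is introduced.

* `wrinkleNodeCoords : ℝ⁴ ≃L[ℝ] ℝ⁴`, `(t, x, y, z) ↦ (t - z, x + y, t + z, x - y)`, and
  `euclideanTwoEquivComplex : ℝ² ≃L[ℝ] ℂ`;
* `lefschetzNodeMap_wrinkleNodeCoords` — `w₁ w₂ = W₀` (as a complex number);
* `det_wrinkleNodeCoords` (`= 4`), `wrinklingLefschetzChart`, and
  `isLefschetzCriticalPoint_wrinklingMap_zero`.

## References

* Y. Lekili, *Wrinkled fibrations on near-symplectic manifolds*, Geom. Topol. 13 (2009)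
  277–318 (arXiv:0712.2202), §3, Move 4. [Lekili2009]
* R. İ. Baykur, O. Saeki, *Simplifying indefinite fibrations on 4-manifolds*, arXiv:1705.11169,
  §2.1 (Lefschetz model `(z₁, z₂) ↦ z₁ z₂`), §3.1 (move `W`). [BaykurSaeki2017]
-/

noncomputable section

open Set Function
open scoped Manifold ContDiff

namespace Literature.Topology.FourManifolds

/-- Local notation: `𝔼 n` is the model Euclidean space `EuclideanSpace ℝ (Fin n)`. -/
local notation "𝔼 " n:arg => EuclideanSpace ℝ (Fin n)

/-! ### The linear coordinate change `(t, x, y, z) ↦ (t - z, x + y, t + z, x - y)` -/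

/-- The coordinate functionals of `ℝ⁴`. [folklore] -/
private def P4 (i : Fin 4) : 𝔼 4 →L[ℝ] ℝ := EuclideanSpace.proj i

/-- The linear map `(t, x, y, z) ↦ (t - z, x + y, t + z, x - y)` (real and imaginary parts of
`w₁ = z₁ + i z₂`, `w₂ = z₁ - i z₂`). [folklore] -/
def wrinkleNodeLinear : 𝔼 4 →L[ℝ] 𝔼 4 :=
  (P4 0 - P4 3).smulRight (EuclideanSpace.single (0 : Fin 4) (1 : ℝ)) +
    (P4 1 + P4 2).smulRight (EuclideanSpace.single (1 : Fin 4) (1 : ℝ)) +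
    (P4 0 + P4 3).smulRight (EuclideanSpace.single (2 : Fin 4) (1 : ℝ)) +
    (P4 1 - P4 2).smulRight (EuclideanSpace.single (3 : Fin 4) (1 : ℝ))

/-- Its inverse `(a, b, c, d) ↦ ((a + c)/2, (b + d)/2, (b - d)/2, (c - a)/2)`. [folklore] -/
def wrinkleNodeLinearInv : 𝔼 4 →L[ℝ] 𝔼 4 :=
  ((2 : ℝ)⁻¹ • P4 0 + (2 : ℝ)⁻¹ • P4 2).smulRight (EuclideanSpace.single (0 : Fin 4) (1 : ℝ)) +
    ((2 : ℝ)⁻¹ • P4 1 + (2 : ℝ)⁻¹ • P4 3).smulRight (EuclideanSpace.single (1 : Fin 4) (1 : ℝ)) +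
    ((2 : ℝ)⁻¹ • P4 1 - (2 : ℝ)⁻¹ • P4 3).smulRight (EuclideanSpace.single (2 : Fin 4) (1 : ℝ)) +
    ((2 : ℝ)⁻¹ • P4 2 - (2 : ℝ)⁻¹ • P4 0).smulRight (EuclideanSpace.single (3 : Fin 4) (1 : ℝ))

/-- Pointwise formula for `wrinkleNodeLinear`. [folklore] -/
theorem wrinkleNodeLinear_apply (q : 𝔼 4) :
    wrinkleNodeLinear q = WithLp.toLp 2 ![q 0 - q 3, q 1 + q 2, q 0 + q 3, q 1 - q 2] := by
  ext i
  fin_cases i <;> simp [wrinkleNodeLinear, P4]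

/-- Pointwise formula for `wrinkleNodeLinearInv`. [folklore] -/
theorem wrinkleNodeLinearInv_apply (q : 𝔼 4) :
    wrinkleNodeLinearInv q = WithLp.toLp 2
      ![2⁻¹ * q 0 + 2⁻¹ * q 2, 2⁻¹ * q 1 + 2⁻¹ * q 3, 2⁻¹ * q 1 - 2⁻¹ * q 3,
        2⁻¹ * q 2 - 2⁻¹ * q 0] := by
  ext i
  fin_cases i <;> simp [wrinkleNodeLinearInv, P4]

/-- **The coordinate change `w = (z₁ + i z₂, z₁ - i z₂)` as a continuous linear automorphism of
`ℝ⁴`.** [folklore] -/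
def wrinkleNodeCoords : 𝔼 4 ≃L[ℝ] 𝔼 4 :=
  ContinuousLinearEquiv.equivOfInverse wrinkleNodeLinear wrinkleNodeLinearInv
    (fun q => by
      rw [wrinkleNodeLinearInv_apply, wrinkleNodeLinear_apply]
      ext i
      fin_cases i <;> simp <;> ring)
    (fun q => by
      rw [wrinkleNodeLinear_apply, wrinkleNodeLinearInv_apply]
      ext i
      fin_cases i <;> simp <;> ring)

/-- The coercion of `wrinkleNodeCoords` to a continuous linear map is `wrinkleNodeLinear`.
[folklore] -/
theorem coe_wrinkleNodeCoords :
    (wrinkleNodeCoords : 𝔼 4 →L[ℝ] 𝔼 4) = wrinkleNodeLinear := rfl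

/-- Pointwise formula for `wrinkleNodeCoords`. [folklore] -/
theorem wrinkleNodeCoords_apply (q : 𝔼 4) :
    wrinkleNodeCoords q = WithLp.toLp 2 ![q 0 - q 3, q 1 + q 2, q 0 + q 3, q 1 - q 2] :=
  wrinkleNodeLinear_apply q

/-- **The coordinate change is orientation preserving: `det = 4`** (it is the complex-linear map
`(z₁, z₂) ↦ (z₁ + i z₂, z₁ - i z₂)` of complex determinant `-2i`, real determinant `|−2i|² = 4`).
[folklore] -/
theorem det_wrinkleNodeCoords :
    LinearMap.det (wrinkleNodeCoords : 𝔼 4 →L[ℝ] 𝔼 4).toLinearMap = 4 := by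
  rw [coe_wrinkleNodeCoords, ← LinearMap.det_toMatrix (EuclideanSpace.basisFun (Fin 4) ℝ).toBasis,
    Matrix.det_succ_row_zero]
  simp [Fin.sum_univ_succ, Matrix.det_succ_row_zero, LinearMap.toMatrix_apply,
    wrinkleNodeLinear_apply, Matrix.submatrix, Fin.succAbove]
  norm_num

/-! ### `ℝ² ≅ ℂ` and the identity `w₁ w₂ = W₀` -/

/-- The identification `ℝ² ≅ ℂ`, `(a, b) ↦ a + i b`, as a continuous linear equivalence.
[folklore] -/
def euclideanTwoEquivComplex : 𝔼 2 ≃L[ℝ] ℂ :=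
  ContinuousLinearEquiv.equivOfInverse
    (Complex.equivRealProdCLM.symm.toContinuousLinearMap.comp
      ((EuclideanSpace.proj (0 : Fin 2) : 𝔼 2 →L[ℝ] ℝ).prod
        (EuclideanSpace.proj (1 : Fin 2) : 𝔼 2 →L[ℝ] ℝ)))
    (Complex.reCLM.smulRight (EuclideanSpace.single (0 : Fin 2) (1 : ℝ)) +
      Complex.imCLM.smulRight (EuclideanSpace.single (1 : Fin 2) (1 : ℝ)))
    (fun w => by
      ext i
      fin_cases i <;> simp)
    (fun c => by
      apply Complex.ext <;> simp)

/-- Pointwise formula: `euclideanTwoEquivComplex w = ⟨w₀, w₁⟩`. [folklore] -/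
@[simp] theorem euclideanTwoEquivComplex_apply (w : 𝔼 2) :
    euclideanTwoEquivComplex w = ⟨w 0, w 1⟩ := by
  apply Complex.ext <;> simp [euclideanTwoEquivComplex]

/-- **`W₀` is the node in the coordinates `w`:** `w₁ w₂ = (t² - x² + y² - z²) + i (2tx + 2yz)`,
i.e. `lefschetzNodeMap (wrinkleNodeCoords q) = W₀ q` read as a complex number.
[cite: Lekili2009, §3 Move 4] -/
theorem lefschetzNodeMap_wrinkleNodeCoords (q : 𝔼 4) :
    lefschetzNodeMap (wrinkleNodeCoords q) = euclideanTwoEquivComplex (wrinklingMap 0 q) := by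
  rw [wrinkleNodeCoords_apply, euclideanTwoEquivComplex_apply]
  apply Complex.ext
  · simp [lefschetzNodeMap, wrinklingMap]
    ring
  · simp [lefschetzNodeMap, wrinklingMap]
    ring

/-! ### The Lefschetz chart and positivity -/

/-- **A Lefschetz chart of `W₀` at the origin**: total-space chart the linear coordinate change
`wrinkleNodeCoords` (global), base chart `ℝ² ≅ ℂ`; in these charts `W₀ = w₁ w₂`.
[cite: Lekili2009, §3 Move 4] -/
def wrinklingLefschetzChart : LefschetzChart (𝓡 4) (𝓡 2) (wrinklingMap 0) (0 : 𝔼 4) where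
  φ := wrinkleNodeCoords.toHomeomorph.toOpenPartialHomeomorph
  ψ := euclideanTwoEquivComplex.toHomeomorph.toOpenPartialHomeomorph
  mem_source := by simp
  apply_eq_zero := by
    show wrinkleNodeCoords 0 = 0
    exact map_zero _
  mapsTo := by simp [MapsTo]
  contMDiffOn := (contMDiff_iff_contDiff.2 wrinkleNodeCoords.contDiff).contMDiffOn
  contMDiffOn_symm := (contMDiff_iff_contDiff.2 wrinkleNodeCoords.symm.contDiff).contMDiffOn
  contMDiffOn_base := (contMDiff_iff_contDiff.2 euclideanTwoEquivComplex.contDiff).contMDiffOn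
  contMDiffOn_base_symm :=
    (contMDiff_iff_contDiff.2 euclideanTwoEquivComplex.symm.contDiff).contMDiffOn
  node_eq := fun q _ => (lefschetzNodeMap_wrinkleNodeCoords q).symm

/-- The differential of the total-space chart at `0` is the coordinate change itself. [folklore] -/
theorem mfderiv_wrinklingLefschetzChart_φ :
    mfderiv (𝓡 4) (𝓡 4) wrinklingLefschetzChart.φ (0 : 𝔼 4) =
      (wrinkleNodeCoords : 𝔼 4 →L[ℝ] 𝔼 4) := by
  show mfderiv (𝓡 4) (𝓡 4) (wrinkleNodeCoords : 𝔼 4 → 𝔼 4) 0 = _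
  rw [mfderiv_eq_fderiv, wrinkleNodeCoords.fderiv]

/-- **The chart is positive** for the standard orientation of `ℝ⁴`: `det = 4 > 0`.
[cite: Lekili2009, §3 Move 4] -/
theorem wrinklingLefschetzChart_isPositive :
    wrinklingLefschetzChart.IsPositive (SmoothOrientation.euclidean 4) := by
  rw [LefschetzChart.isPositive_iff, SmoothOrientation.euclidean_apply,
    mfderiv_wrinklingLefschetzChart_φ]
  refine iff_of_true rfl ?_
  -- the tangent spaces of the model space are the model space: restate with its instances
  change 0 < LinearMap.det (wrinkleNodeCoords : 𝔼 4 →L[ℝ] 𝔼 4).toLinearMap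
  rw [det_wrinkleNodeCoords]
  norm_num

/-- **The origin is a positive Lefschetz critical point of `W₀ = (t² - x² + y² - z², 2tx + 2yz)`**
for the standard orientation of `ℝ⁴` — the singularity that Lekili's Move 4 / Baykur–Saeki's
move `W` replaces by a wrinkle with a triple-cuspoid base diagram
(`WrinklingMoveTripleCuspoid.lean`). [cite: Lekili2009, §3 Move 4] -/
theorem isLefschetzCriticalPoint_wrinklingMap_zero :
    IsLefschetzCriticalPoint (𝓡 4) (𝓡 2) (SmoothOrientation.euclidean 4) (wrinklingMap 0)
      (0 : 𝔼 4) true :=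
  ⟨wrinklingLefschetzChart, by simpa using wrinklingLefschetzChart_isPositive⟩

end Literature.Topology.FourManifolds

end
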